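import Mathlib.Analysis.InnerProductSpace.Positive
import Mathlib.Analysis.InnerProductSpace.Trace
import Mathlib.Analysis.Matrix.Order
import Mathlib.LinearAlgebra.Matrix.PosDef
import Mathlib.LinearAlgebra.Semisimple
import Literature.Analysis.InnerProduct.KroneckerEigenvalues
import HarnessLib

/-!
# Serre's Kähler analogues of the Weil conjectures — the linear algebra of the proofs

Topic `Literature/AlgebraicGeometry/HodgeTheory`; grouping namespace `Serre1960`. All proved; no
definitions; no named facts.

J.-P. Serre, *Analogues kählériens de certaines conjectures de Weil*, Ann. of Math. 71 (1960)
392–394 [Serre1960Kahler] proves, for a smooth projective `V/ℂ` and a morphism `f : V → V` with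
`f⁻¹(E) ≡ q·E` for a hyperplane section `E` (`q > 0` an integer):

* **Théorème 1** (p. 392): the eigenvalues of `f_r^*` on `H^r(V, ℂ)` have absolute value `q^{r/2}`
  ("l'analogue kählérien de l'hypothèse de Riemann");
* (p. 393) `g_r = q^{-r/2} f_r^*` and `g_{2n-r}` are transposed to one another for the cup-product
  pairing `I(a,b)`, so the eigenvalues of `f_{2n-r}^*` are `qⁿ/λ₁, …, qⁿ/λ_k` ("l'équation
  fonctionnelle");
* **Théorème 2** (p. 393): for a correspondence `X` compatible with the Kähler structures and
  `X'_r = L_V^{r-n} ∘ ᵗX_{2n-r} ∘ L_W^{n-r}`, `Tr(X_r ∘ X'_r) ≥ 0`, and `= 0` only if `X_r = 0`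
  (the Kähler "formule de Castelnuovo" `σ(ξ ∘ ξ') > 0`).

The PROOFS are three lines of linear algebra once Hodge theory has supplied the positive hermitian
form `T_V(a,b) = A(a, C b̄)` on `H^r(V, ℂ)` (Weil, *Variétés kählériennes*, pp. 77–78): (1) `g`
respects `T_V`, i.e. is UNITARY for a positive-definite hermitian form, hence its eigenvalues have
absolute value `1` (p. 393, lines 13–18); (2) `X_r` and `X'_r` are ADJOINT for `T_V`, `T_W`, so
`Tr(X_r ∘ X'_r)` is the Hilbert–Schmidt norm of `X_r` (p. 394, lines 1–3). This file proves exactly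
these mechanisms, in two spellings:

* MATRIX / GRAM-MATRIX FORM (`section GramMatrix`), the shape in which a finite-level computation
  meets them: `T` a positive-definite hermitian matrix, `Fᴴ T F = c • T` ("`F` is a
  `c`-similitude of `T`", Serre's `q^{-r/2} f_r^*` unitary ⟺ `c = q^r`) ⟹ every eigenvalue `μ` of
  `F` has `‖μ‖² = c` (`norm_sq_eq_of_conjTranspose_mul_mul_eq_smul`, root-of-`charpoly` form
  `norm_sq_eq_of_mem_roots_charpoly`, Serre's normalisation `norm_eq_sqrt_pow_of_mem_roots_charpoly`:
  `‖μ‖ = (√q)^r`); and the cup-product pairing form of the functional equation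
  (`eigenvalue_mul_eigenvalue_of_transpose_mul_mul_eq_smul`: `Fᵀ J G = c • J`, `F v = λ v`,
  `G w = μ w` ⟹ `λ μ · (vᵀ J w) = c · (vᵀ J w)`).
* INNER-PRODUCT FORM (`section HermitianForm`), Serre's own wording with `T_V`, `T_W` the inner
  products of finite-dimensional inner product spaces over `𝕜 = ℝ` or `ℂ`:
  `norm_sq_eq_of_inner_map_map` (a `c`-similitude has eigenvalues of norm-square `c`; `c = 1`:
  unitary ⟹ norm `1`, `norm_eq_one_of_inner_map_map`), `trace_comp_adjoint_eq_sum_norm_sq`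
  (`Tr(X ∘ X†) = Σ ‖X† bᵢ‖²`, the Hilbert–Schmidt norm), `trace_comp_adjoint_nonneg`,
  `trace_comp_adjoint_eq_zero_iff`, and Théorème 2 as printed, for an ADJOINT PAIR `(X, X')`:
  `serre_theorem2_of_adjoint_pair`.
* SEMISIMPLICITY (`section Semisimple`, appended; B. C. Hall, *Lie Groups, Lie Algebras, and
  Representations*, 2nd ed. (2015), Prop. 4.27 «a finite-dimensional unitary representation is
  completely reducible», proof via `W^⊥` [Hall2015]): a `c`-similitude (`c ≠ 0`) of a
  finite-dimensional inner product space is injective, maps every stable subspace onto itself, has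
  `pᗮ` stable whenever `p` is (`orthogonal_mem_invtSubmodule_of_inner_map_map`), hence is a
  SEMISIMPLE endomorphism (`isSemisimple_of_inner_map_map`, `isSemisimple_smul_of_inner_map_map`) —
  the correspondence-category twin of `Literature.NumberTheory.Deninger2022.semisimple_of_polarized`.

Deninger–Singhof, *Real polarizable Hodge structures arising from foliations* (Ann. Global Anal.
Geom. 21 (2002)) = arXiv:math/0204111 [DeningerSinghof2002], Prop. 4.6 (arXiv p. 7) transfers
Théorème 1 verbatim to the reduced leafwise cohomology `H̄ⁿ_𝓕(X, ℂ)` of a Kähler–Riemann foliation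
with a dense leaf (`f^* = q^{n/2} U_n`, `U_n` unitary for the scalar product `T` of their eq. (4));
the linear algebra is the same and is the one recorded here ("the classical case is contained in the
foliation formalism by taking for `𝓕` the foliation which consists of the leaf `X` only", loc. cit.
p. 2).

Deliberately NOT here (geometry, not linear algebra): the construction and positivity of `T_V` (the
Hodge–Riemann bilinear relations; cf. the tree's `HardLefschetzHodgeRiemann`,
`HodgeIndexPrimitiveAlgebraic`), the fact that `f^*` respects `T_V` (Serre p. 393: `g` is an algebra
endomorphism fixing `u`, real, compatible with the bigrading), hard Lefschetz defining `X'_r`, and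
the deduction "Théorème 2 ⟹ Théorème 1" through the ring generated by `f^*` and Weil's
`σ(ξ ∘ ξ') > 0` argument (p. 394), which needs the power-sum estimate for all iterates.
-/

noncomputable section

namespace Literature.AlgebraicGeometry.HodgeTheory

namespace Serre1960

/-! ## Gram-matrix form: a similitude of a positive-definite hermitian form -/

section GramMatrix

open Matrix
open scoped ComplexOrder

variable {n : Type*} [Fintype n]

/-- The quadratic identity behind Serre's Théorème 1: for ANY square matrices `T, F` and any vector
`v` with `F v = μ • v`, `v̄ᵀ (Fᴴ T F) v = (μ̄ μ) · v̄ᵀ T v`. [cite: Serre1960Kahler, p. 393 (proof of Thm 1: `g` respecte `T_V`)] -/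
theorem star_dotProduct_conjTranspose_mul_mul_mulVec_of_mulVec_eq_smul (T F : Matrix n n ℂ)
    {μ : ℂ} {v : n → ℂ} (hFv : F *ᵥ v = μ • v) :
    star v ⬝ᵥ ((Fᴴ * T * F) *ᵥ v) = (star μ * μ) * (star v ⬝ᵥ (T *ᵥ v)) := by
  rw [← Matrix.mulVec_mulVec, ← Matrix.mulVec_mulVec, Matrix.dotProduct_mulVec,
    ← Matrix.star_mulVec, hFv, star_smul, Matrix.mulVec_smul, smul_dotProduct, dotProduct_smul,
    smul_eq_mul, smul_eq_mul, mul_assoc]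

/-- **Serre 1960, mechanism of Théorème 1 (Gram-matrix form).** Let `T` be a positive-definite
hermitian matrix and `F` a `c`-SIMILITUDE of the hermitian form `v̄ᵀ T w`, i.e. `Fᴴ T F = c • T`
(for `c = 1`: `F` is `T`-unitary — Serre's `g_r = q^{-r/2} f_r^*`; in general `c = q^r`). Then every
eigenvalue `μ` of `F` (`F v = μ v`, `v ≠ 0`) satisfies `‖μ‖² = c`: "g respecte `T_V`, autrement dit
c'est un opérateur unitaire; les valeurs propres de g ont donc une valeur absolue égale à 1".
[cite: Serre1960Kahler, Thm 1 and its proof, pp. 392–393] -/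
theorem norm_sq_eq_of_conjTranspose_mul_mul_eq_smul {T F : Matrix n n ℂ} (hT : T.PosDef) {c : ℝ}
    (hF : Fᴴ * T * F = (c : ℂ) • T) {μ : ℂ} {v : n → ℂ} (hv : v ≠ 0) (hFv : F *ᵥ v = μ • v) :
    ‖μ‖ ^ 2 = c := by
  have h1 := star_dotProduct_conjTranspose_mul_mul_mulVec_of_mulVec_eq_smul T F hFv
  rw [hF, Matrix.smul_mulVec, dotProduct_smul, smul_eq_mul] at h1
  -- `h1 : c * p = (μ̄ μ) * p` with `p = v̄ᵀ T v > 0`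
  have hp : star v ⬝ᵥ (T *ᵥ v) ≠ 0 := (hT.dotProduct_mulVec_pos hv).ne'
  have h2 : star μ * μ = (c : ℂ) := (mul_right_cancel₀ hp h1).symm
  rw [Complex.star_def, Complex.conj_mul'] at h2
  exact_mod_cast h2

/-- Root-of-the-characteristic-polynomial spelling of `norm_sq_eq_of_conjTranspose_mul_mul_eq_smul`:
if `T` is positive definite and `Fᴴ T F = c • T`, every root `μ` of `χ_F` (= every eigenvalue of `F`)
has `‖μ‖² = c`. [cite: Serre1960Kahler, Thm 1, pp. 392–393] -/
theorem norm_sq_eq_of_mem_roots_charpoly [DecidableEq n] {T F : Matrix n n ℂ} (hT : T.PosDef) {c : ℝ}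
    (hF : Fᴴ * T * F = (c : ℂ) • T) {μ : ℂ} (hμ : μ ∈ F.charpoly.roots) : ‖μ‖ ^ 2 = c := by
  obtain ⟨v, hv, hFv⟩ :=
    Literature.Analysis.InnerProduct.exists_mulVec_eq_smul_of_mem_roots_charpoly hμ
  exact norm_sq_eq_of_conjTranspose_mul_mul_eq_smul hT hF hv hFv

/-- **Serre 1960, Théorème 1 in its printed normalisation (Gram-matrix form).** If `T` is positive
definite, `q ≥ 0`, and `Fᴴ T F = q^r • T` (i.e. `q^{-r/2} F` is `T`-unitary), then every root `μ`
of `χ_F` has absolute value `q^{r/2} = (√q)^r` — "les valeurs propres de l'endomorphisme `f_r^*` de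
`H^r(V, ℂ)` défini par `f` ont pour valeur absolue `q^{r/2}`". The geometric input producing the
hypothesis (`f^*` respects Weil's form `T_V`) is not formalised here. [cite: Serre1960Kahler, Thm 1, p. 392] -/
theorem norm_eq_sqrt_pow_of_mem_roots_charpoly [DecidableEq n] {T F : Matrix n n ℂ} (hT : T.PosDef)
    {q : ℝ} (hq : 0 ≤ q) (r : ℕ) (hF : Fᴴ * T * F = ((q : ℂ) ^ r) • T) {μ : ℂ}
    (hμ : μ ∈ F.charpoly.roots) : ‖μ‖ = Real.sqrt q ^ r := by
  have hF' : Fᴴ * T * F = ((q ^ r : ℝ) : ℂ) • T := by rw [hF]; push_cast; rfl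
  have h := norm_sq_eq_of_mem_roots_charpoly hT hF' hμ
  have h2 : ‖μ‖ ^ 2 = (Real.sqrt q ^ r) ^ 2 := by
    rw [h, ← pow_mul, mul_comm, pow_mul, Real.sq_sqrt hq]
  exact (pow_left_inj₀ (norm_nonneg μ) (by positivity) two_ne_zero).mp h2

/-- The `c = 1` case: a `T`-UNITARY matrix (`Fᴴ T F = T`, `T` positive definite) has all roots of
its characteristic polynomial on the unit circle (Serre's `g`). [cite: Serre1960Kahler, p. 393 (proof of Thm 1)] -/
theorem norm_eq_one_of_mem_roots_charpoly [DecidableEq n] {T F : Matrix n n ℂ} (hT : T.PosDef)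
    (hF : Fᴴ * T * F = T) {μ : ℂ} (hμ : μ ∈ F.charpoly.roots) : ‖μ‖ = 1 := by
  have hF' : Fᴴ * T * F = ((1 : ℝ) : ℂ) • T := by rw [hF]; simp
  have h := norm_sq_eq_of_mem_roots_charpoly hT hF' hμ
  have h2 : ‖μ‖ ^ 2 = 1 ^ 2 := by rw [h, one_pow]
  exact (pow_left_inj₀ (norm_nonneg μ) zero_le_one two_ne_zero).mp h2

/-- **The functional equation, pairing form** (Serre p. 393: `g_r` and `g_{2n-r}` are transposed
to one another for `I(a,b)`, so the eigenvalues of `f^*_{2n-r}` are `qⁿ/λᵢ`). Linear algebra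
recorded: if two endomorphisms `F` (of `ι → R`) and `G` (of `κ → R`) satisfy
`I(F a, G b) = c · I(a, b)` for a bilinear pairing `I(a, b) = aᵀ J b` — as matrices
`Fᵀ J G = c • J`; for `f^*` on `H^r × H^{2n-r}` this holds with `c = qⁿ` because `f^*` is
multiplicative for the cup product and acts by `qⁿ` on `H^{2n}` — then eigenvalues PAIR OFF: for
eigenvectors `F v = λ v`, `G w = μ w` one has `λ μ · I(v, w) = c · I(v, w)`, so `λ μ = c` whenever
`I(v, w) ≠ 0`. (The counting statement "the eigenvalues of `G` are exactly the `c/λᵢ`" needs the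
non-degeneracy of `I` and is not recorded.) [cite: Serre1960Kahler, p. 393 (analogue of the functional equation)] -/
theorem eigenvalue_mul_eigenvalue_of_transpose_mul_mul_eq_smul {ι κ R : Type*} [Fintype ι]
    [Fintype κ] [CommRing R] {F : Matrix ι ι R} {G : Matrix κ κ R} {J : Matrix ι κ R} {c : R}
    (h : Fᵀ * J * G = c • J) {lam mu : R} {v : ι → R} {w : κ → R} (hv : F *ᵥ v = lam • v)
    (hw : G *ᵥ w = mu • w) : lam * mu * (v ⬝ᵥ (J *ᵥ w)) = c * (v ⬝ᵥ (J *ᵥ w)) := by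
  have h1 : v ⬝ᵥ ((Fᵀ * J * G) *ᵥ w) = lam * mu * (v ⬝ᵥ (J *ᵥ w)) := by
    rw [← Matrix.mulVec_mulVec, ← Matrix.mulVec_mulVec, Matrix.dotProduct_mulVec,
      Matrix.vecMul_transpose, hv, hw, Matrix.mulVec_smul, smul_dotProduct, dotProduct_smul,
      smul_eq_mul, smul_eq_mul, mul_assoc]
  rw [← h1, h, Matrix.smul_mulVec, dotProduct_smul, smul_eq_mul]

/-- If moreover the eigenvectors pair non-trivially (`I(v, w) ≠ 0`) and `R` has no zero divisors,
the eigenvalues multiply to the similitude factor: `λ μ = c` (for `f^*`: `λ μ = qⁿ`, i.e.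
`μ = qⁿ/λ`). [cite: Serre1960Kahler, p. 393 (analogue of the functional equation)] -/
theorem eigenvalue_mul_eigenvalue_eq_of_dotProduct_ne_zero {ι κ R : Type*} [Fintype ι]
    [Fintype κ] [CommRing R] [NoZeroDivisors R] {F : Matrix ι ι R} {G : Matrix κ κ R}
    {J : Matrix ι κ R} {c : R} (h : Fᵀ * J * G = c • J) {lam mu : R} {v : ι → R} {w : κ → R}
    (hv : F *ᵥ v = lam • v) (hw : G *ᵥ w = mu • w) (hI : v ⬝ᵥ (J *ᵥ w) ≠ 0) : lam * mu = c :=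
  mul_right_cancel₀ hI (eigenvalue_mul_eigenvalue_of_transpose_mul_mul_eq_smul h hv hw)

end GramMatrix

/-! ## Inner-product form: Serre's `T_V`, `T_W` as the inner products -/

section HermitianForm

open scoped InnerProductSpace ComplexOrder

variable {𝕜 : Type*} [RCLike 𝕜]
variable {V W : Type*} [NormedAddCommGroup V] [InnerProductSpace 𝕜 V] [NormedAddCommGroup W]
  [InnerProductSpace 𝕜 W]

/-- **Serre 1960, mechanism of Théorème 1 (hermitian-form spelling).** An endomorphism `f` of an
inner product space which is a `c`-similitude, `⟪f a, f b⟫ = c · ⟪a, b⟫` (`c = 1`: `f` unitary,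
"respecte `T_V`"), has every eigenvalue of norm-square `c`: `f v = μ v`, `v ≠ 0` ⟹ `‖μ‖² = c`.
[cite: Serre1960Kahler, p. 393 (proof of Thm 1)] -/
theorem norm_sq_eq_of_inner_map_map (f : V →ₗ[𝕜] V) {c : ℝ}
    (hf : ∀ a b : V, ⟪f a, f b⟫_𝕜 = (c : 𝕜) * ⟪a, b⟫_𝕜) {μ : 𝕜} {v : V} (hv : v ≠ 0)
    (hfv : f v = μ • v) : ‖μ‖ ^ 2 = c := by
  have h := hf v v
  rw [hfv, inner_smul_left, inner_smul_right, ← mul_assoc] at h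
  have hvv : ⟪v, v⟫_𝕜 ≠ 0 := inner_self_ne_zero.mpr hv
  have h2 : (starRingEnd 𝕜) μ * μ = (c : 𝕜) := mul_right_cancel₀ hvv h
  rw [RCLike.conj_mul] at h2
  exact_mod_cast h2

/-- `Module.End.HasEigenvalue` spelling of `norm_sq_eq_of_inner_map_map`. [cite: Serre1960Kahler, p. 393 (proof of Thm 1)] -/
theorem norm_sq_eq_of_inner_map_map_of_hasEigenvalue (f : V →ₗ[𝕜] V) {c : ℝ}
    (hf : ∀ a b : V, ⟪f a, f b⟫_𝕜 = (c : 𝕜) * ⟪a, b⟫_𝕜) {μ : 𝕜}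
    (hμ : Module.End.HasEigenvalue f μ) :
    ‖μ‖ ^ 2 = c := by
  obtain ⟨v, hv⟩ := hμ.exists_hasEigenvector
  exact norm_sq_eq_of_inner_map_map f hf hv.2 hv.apply_eq_smul

/-- Serre's sentence itself: a UNITARY endomorphism (`⟪g a, g b⟫ = ⟪a, b⟫`) of an inner product
space has eigenvalues of absolute value `1`. [cite: Serre1960Kahler, p. 393 (proof of Thm 1)] -/
theorem norm_eq_one_of_inner_map_map (g : V →ₗ[𝕜] V) (hg : ∀ a b : V, ⟪g a, g b⟫_𝕜 = ⟪a, b⟫_𝕜)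
    {μ : 𝕜} {v : V} (hv : v ≠ 0) (hgv : g v = μ • v) : ‖μ‖ = 1 := by
  have hg' : ∀ a b : V, ⟪g a, g b⟫_𝕜 = ((1 : ℝ) : 𝕜) * ⟪a, b⟫_𝕜 := fun a b => by
    rw [hg a b]; simp
  have h := norm_sq_eq_of_inner_map_map g hg' hv hgv
  have h2 : ‖μ‖ ^ 2 = 1 ^ 2 := by rw [h, one_pow]
  exact (pow_left_inj₀ (norm_nonneg μ) zero_le_one two_ne_zero).mp h2

variable [FiniteDimensional 𝕜 V] [FiniteDimensional 𝕜 W]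

/-- **The Hilbert–Schmidt norm** (Serre p. 394: "La trace de `X_r ∘ X'_r` n'est donc pas autre
chose que le carré de la norme (au sens d'Hilbert-Schmidt) de l'opérateur `X_r`"): for a linear map
`X : V → W` of finite-dimensional inner product spaces and any orthonormal basis `b` of `W`,
`Tr(X ∘ X†) = Σᵢ ‖X† bᵢ‖²`. [cite: Serre1960Kahler, p. 394 (proof of Thm 2)] -/
theorem trace_comp_adjoint_eq_sum_norm_sq (X : V →ₗ[𝕜] W) {ι : Type*} [Fintype ι]
    (b : OrthonormalBasis ι 𝕜 W) :
    LinearMap.trace 𝕜 W (X ∘ₗ LinearMap.adjoint X) =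
      ∑ i, ((‖LinearMap.adjoint X (b i)‖ ^ 2 : ℝ) : 𝕜) := by
  rw [LinearMap.trace_eq_sum_inner _ b]
  refine Finset.sum_congr rfl fun i _ => ?_
  rw [LinearMap.comp_apply, ← LinearMap.adjoint_inner_left, inner_self_eq_norm_sq_to_K]
  norm_cast

/-- `Tr(X ∘ X†) ≥ 0` (a non-negative real number, stated in `𝕜` with its star order).
[cite: Serre1960Kahler, Thm 2, p. 393] -/
theorem trace_comp_adjoint_nonneg (X : V →ₗ[𝕜] W) :
    0 ≤ LinearMap.trace 𝕜 W (X ∘ₗ LinearMap.adjoint X) :=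
  (LinearMap.isPositive_self_comp_adjoint X).trace_nonneg

/-- `Tr(X ∘ X†) = 0` only for `X = 0` ("de plus, si `Tr(X_r ∘ X'_r) = 0`, on a `X_r = 0`").
[cite: Serre1960Kahler, Thm 2, p. 393] -/
theorem trace_comp_adjoint_eq_zero_iff (X : V →ₗ[𝕜] W) :
    LinearMap.trace 𝕜 W (X ∘ₗ LinearMap.adjoint X) = 0 ↔ X = 0 := by
  refine ⟨fun h => ?_, fun h => by simp [h]⟩
  set b := stdOrthonormalBasis 𝕜 W
  rw [trace_comp_adjoint_eq_sum_norm_sq X b] at h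
  have h' : ∑ i, ‖LinearMap.adjoint X (b i)‖ ^ 2 = (0 : ℝ) := by exact_mod_cast h
  have hz : ∀ i, LinearMap.adjoint X (b i) = 0 := fun i => by
    have hi := (Finset.sum_eq_zero_iff_of_nonneg fun j _ => sq_nonneg _).mp h' i (Finset.mem_univ i)
    exact norm_eq_zero.mp (pow_eq_zero_iff two_ne_zero |>.mp hi)
  have hadj : LinearMap.adjoint X = 0 :=
    b.toBasis.ext fun i => by simpa only [OrthonormalBasis.coe_toBasis, LinearMap.zero_apply] using hz i
  have hX := congrArg LinearMap.adjoint hadj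
  rwa [LinearMap.adjoint_adjoint, map_zero] at hX

/-- **Serre 1960, Théorème 2 — the mechanism as printed.** Let `X : V → W` and `X' : W → V` be
linear maps between finite-dimensional (hermitian) inner product spaces which are ADJOINT to one
another, `⟪X a, b⟫_W = ⟪a, X' b⟫_V` ("les opérateurs `X_r` et `X'_r` sont adjoints l'un de l'autre
par rapport aux formes `T_v` et `T_w`"). Then `Tr(X ∘ X') ≥ 0`, and `Tr(X ∘ X') = 0` implies
`X = 0`. For Kähler correspondences compatible with the Kähler structures, Serre shows that
`X'_r = L_V^{r-n} ∘ ᵗX_{2n-r} ∘ L_W^{n-r}` is such an adjoint (hypothesis (c)); that geometric step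
is not formalised here. [cite: Serre1960Kahler, Thm 2, pp. 393–394] -/
theorem serre_theorem2_of_adjoint_pair (X : V →ₗ[𝕜] W) (X' : W →ₗ[𝕜] V)
    (hadj : ∀ (a : V) (b : W), ⟪X a, b⟫_𝕜 = ⟪a, X' b⟫_𝕜) :
    0 ≤ LinearMap.trace 𝕜 W (X ∘ₗ X') ∧ (LinearMap.trace 𝕜 W (X ∘ₗ X') = 0 → X = 0) := by
  have hX' : X' = LinearMap.adjoint X := by
    refine (LinearMap.eq_adjoint_iff X' X).mpr fun b a => ?_
    calc ⟪X' b, a⟫_𝕜 = (starRingEnd 𝕜) ⟪a, X' b⟫_𝕜 := (inner_conj_symm _ _).symm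
      _ = (starRingEnd 𝕜) ⟪X a, b⟫_𝕜 := by rw [hadj]
      _ = ⟪b, X a⟫_𝕜 := inner_conj_symm _ _
  subst hX'
  exact ⟨trace_comp_adjoint_nonneg X, (trace_comp_adjoint_eq_zero_iff X).mp⟩

end HermitianForm

/-! ## Semisimplicity: a similitude of a positive-definite hermitian form is semisimple

Serre's `g` is unitary for `T_V`, hence (like any isometry of a finite-dimensional hermitian space)
a SEMISIMPLE endomorphism: the `T_V`-orthogonal complement of a `g`-stable subspace is `g`-stable.
This is the Frobenius/correspondence-category counterpart of the flow statement
`Literature.NumberTheory.Deninger2022.semisimple_of_polarized` ("a polarization forces `θ`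
semisimple"): in the Kähler / polarized setting the analogue of Tate's semisimplicity of Frobenius is
automatic. Folklore linear algebra, recorded because finite-level candidates are typed against it. -/

section Semisimple

open scoped InnerProductSpace

variable {𝕜 : Type*} [RCLike 𝕜]
variable {V : Type*} [NormedAddCommGroup V] [InnerProductSpace 𝕜 V] [FiniteDimensional 𝕜 V]

omit [FiniteDimensional 𝕜 V] in
/-- A `c`-similitude (`⟪f a, f b⟫ = c · ⟪a, b⟫`, `c ≠ 0`) of an inner product space is injective (step of
the complete-reducibility argument for unitary operators). [cite: Hall2015, Prop. 4.27 (proof)] -/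
theorem injective_of_inner_map_map (f : V →ₗ[𝕜] V) {c : 𝕜} (hc : c ≠ 0)
    (hf : ∀ a b : V, ⟪f a, f b⟫_𝕜 = c * ⟪a, b⟫_𝕜) : Function.Injective f := by
  rw [← LinearMap.ker_eq_bot, LinearMap.ker_eq_bot']
  intro a ha
  have h := hf a a
  rw [ha, inner_zero_left] at h
  have h0 : ⟪a, a⟫_𝕜 = 0 := by
    rcases mul_eq_zero.mp h.symm with h1 | h1
    · exact absurd h1 hc
    · exact h1
  exact inner_self_eq_zero.mp h0

/-- A `c`-similitude (`c ≠ 0`) of a finite-dimensional inner product space maps every stable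
subspace ONTO itself (finite-dimensionality replaces the group inverse `Π(A⁻¹) w ∈ W` of the
printed proof). [cite: Hall2015, Prop. 4.27 (proof)] -/
theorem map_eq_of_mem_invtSubmodule_of_inner_map_map (f : V →ₗ[𝕜] V) {c : 𝕜} (hc : c ≠ 0)
    (hf : ∀ a b : V, ⟪f a, f b⟫_𝕜 = c * ⟪a, b⟫_𝕜) {p : Submodule 𝕜 V}
    (hp : p ∈ Module.End.invtSubmodule f) : p.map f = p := by
  have hle : p.map f ≤ p := (Module.End.mem_invtSubmodule_iff_map_le f).mp hp
  refine Submodule.eq_of_le_of_finrank_eq hle ?_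
  exact (LinearEquiv.finrank_eq
    (Submodule.equivMapOfInjective f (injective_of_inner_map_map f hc hf) p)).symm

/-- **The orthogonal complement of a stable subspace of a similitude is stable.** For a
`c`-similitude `f` (`c ≠ 0`) of a finite-dimensional inner product space and an `f`-stable subspace
`p`, the orthogonal complement `pᗮ` is `f`-stable (Serre's `g`: `c = 1`) — the printed step «we claim
that `W^⊥` is also an invariant subspace … `⟨Π(A)v, w⟩ = ⟨v, Π(A^{-1})w⟩ = ⟨v, w'⟩ = 0`» for a single
unitary operator (up to the scalar `c`). [cite: Hall2015, Prop. 4.27 (proof: `W^⊥` is invariant)] -/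
theorem orthogonal_mem_invtSubmodule_of_inner_map_map (f : V →ₗ[𝕜] V) {c : 𝕜} (hc : c ≠ 0)
    (hf : ∀ a b : V, ⟪f a, f b⟫_𝕜 = c * ⟪a, b⟫_𝕜) {p : Submodule 𝕜 V}
    (hp : p ∈ Module.End.invtSubmodule f) : pᗮ ∈ Module.End.invtSubmodule f := by
  rw [Module.End.mem_invtSubmodule_iff_forall_mem_of_mem]
  intro x hx
  rw [Submodule.mem_orthogonal]
  intro u hu
  -- `u ∈ p = f(p)`: write `u = f u'` with `u' ∈ p`
  rw [← map_eq_of_mem_invtSubmodule_of_inner_map_map f hc hf hp] at hu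
  obtain ⟨u', hu', rfl⟩ := Submodule.mem_map.mp hu
  rw [hf, Submodule.inner_right_of_mem_orthogonal hu' hx, mul_zero]

/-- **A similitude of a finite-dimensional hermitian space is a semisimple endomorphism** (every
stable subspace has the stable complement `pᗮ`): Serre's `T_V`-unitary `g = q^{-r/2} f_r^*`, and
hence `f_r^*` itself, is semisimple — the polarized-setting counterpart of Tate's semisimplicity of
Frobenius, and of `Deninger2022.semisimple_of_polarized` for flows. Printed form: «if `Π` is a
finite-dimensional unitary representation then `Π` is completely reducible» (here for the monoid
generated by one similitude; complete reducibility = `Module.End.IsSemisimple`, every stable subspace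
has a stable complement). [cite: Hall2015, Prop. 4.27] -/
theorem isSemisimple_of_inner_map_map (f : V →ₗ[𝕜] V) {c : 𝕜} (hc : c ≠ 0)
    (hf : ∀ a b : V, ⟪f a, f b⟫_𝕜 = c * ⟪a, b⟫_𝕜) : Module.End.IsSemisimple f := by
  rw [Module.End.isSemisimple_iff]
  intro p hp
  exact ⟨pᗮ, orthogonal_mem_invtSubmodule_of_inner_map_map f hc hf hp, p.isCompl_orthogonal⟩

/-- Scalar multiples: if `f` is a `c`-similitude (`c ≠ 0`) then so is `a • f` for `a ≠ 0` (with
factor `ā a c`), hence `a • f` is semisimple too — Serre's passage between `g_r` and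
`f_r^* = q^{r/2} g_r`. [cite: Hall2015, Prop. 4.27] -/
theorem isSemisimple_smul_of_inner_map_map (f : V →ₗ[𝕜] V) {c : 𝕜} (hc : c ≠ 0)
    (hf : ∀ a b : V, ⟪f a, f b⟫_𝕜 = c * ⟪a, b⟫_𝕜) {a : 𝕜} (ha : a ≠ 0) :
    Module.End.IsSemisimple (a • f) := by
  refine isSemisimple_of_inner_map_map (a • f) (c := (starRingEnd 𝕜) a * a * c)
    (mul_ne_zero (mul_ne_zero ((map_ne_zero _).mpr ha) ha) hc) fun x y => ?_
  rw [LinearMap.smul_apply, LinearMap.smul_apply, inner_smul_left, inner_smul_right, hf]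
  ring

end Semisimple

end Serre1960

end Literature.AlgebraicGeometry.HodgeTheory
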